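import Summits.CriticalPhenomena.PercolationContinuityZ3.Theorems.PercNearOneGluingNoHeavyLowerTailSahiTwoLevelSaturation
import Summits.CriticalPhenomena.PercolationContinuityZ3.Theorems.PercNearOneGluingNoHeavyLowerTailSahiClassTSingleCube
import Summits.CriticalPhenomena.PercolationContinuityZ3.Theorems.PercNearOneGluingNoHeavyLowerTailSahiTwoLevelSaturationClassT
import Summits.CriticalPhenomena.PercolationContinuityZ3.Theorems.PercNearOneGluingNoHeavyLowerTailSahiTwoLevelMonomialFace
import Mathlib.Tactic.Linarith
import HarnessLib

/-!
# Kahn's inequality on the saturation-certified class, III: the CO-SUNFLOWER-TOPS MONOMIAL FACE as a certificate of the recursion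

Support file of the one-cut programme (crux `NoHeavyLowerTail`, stmt-CriticalPhenomena-4575; master-family line P2 = Sahi's algebraic route,
seat `prim-masterthm-p2` gen 22; memo `run/shared/lean/prim/prim-masterthm/FROM-prim-masterthm-p2-g22-SATURATION.md` §3–§5).  No definition, no sorry; axioms standard.

`sahiE3_nonneg_of_recursivelySaturatedTM`: the recursion of `…Saturation` / `…SaturationClassT` with one more certificate at a coordinate `e` — a pair `(G', H')` reachable by
moves from the sections whose tops form a co-sunflower (`G'_i ⊆ G'_j ∪ G'_k`) and whose bottom meets lie in the core (`H'_j ∩ H'_k ⊆ G'_i`), with `P (S.erase e) G'`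
(`…MonomialFace.sahiE3_le_topForm_of_coSunflowerTops`: then `T⁺(G',H') ≥ E_3(G') ≥ 0`).  This is the certificate that the minimal obstruction of the containment faces — the
three 4-cycles of `K_4` on four coins — needs; with it the least certified class contains every saturated triple of the 4-cube (census, memo §2). [this work]
-/

noncomputable section

open scoped Classical

namespace Summit.CriticalPhenomena.PercolationContinuityZ3.Theorems

namespace SahiTwoLevelVariational

open Finset Function MeasureTheory
open Literature.Combinatorics.Sahi2008
open Literature.Probability.LatticeModels (prodBernoulli prodBernoulli_harris sahiE3 sahiE3_def)
open Literature.Probability.Percolation (DeterminedBy determinedBy_iff)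
open Literature.Probability.Percolation.DecisionTree (ind ind_of_mem ind_of_not_mem ind_nonneg)

variable {κ : Type} [Fintype κ]

/-- **KAHN'S INEQUALITY ON EVERY SATURATION-CERTIFIED CLASS, WITH CLASS T AND THE MONOMIAL FACE.**  As `sahiE3_nonneg_of_recursivelySaturatedT`, the
coordinate certificate being EITHER a `SatFace` OR a reached pair with co-sunflower tops and core-contained bottom meets plus `P` for its tops. [this work] -/
theorem sahiE3_nonneg_of_recursivelySaturatedTM (q : κ → unitInterval) (P : Finset κ → (Fin 3 → Set (Set κ)) → Prop)
    (hP : ∀ (S : Finset κ) (U : Fin 3 → Set (Set κ)), P S U →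
      (∃ i : Fin 3, ∀ ω : Set κ, (∀ k : Fin 3, k ≠ i → ω ∈ U k) → ω ∈ U i)
      ∨ (∃ T₀ T₁ : Finset κ, (T₀ ∩ T₁).card ≤ 1 ∧
          ((DeterminedBy (U 0) (↑T₀ : Set κ) ∧ DeterminedBy (U 1) (↑T₁ : Set κ))
            ∨ (DeterminedBy (U 1) (↑T₀ : Set κ) ∧ DeterminedBy (U 2) (↑T₁ : Set κ))
            ∨ (DeterminedBy (U 0) (↑T₀ : Set κ) ∧ DeterminedBy (U 2) (↑T₁ : Set κ))))
      ∨ (∀ x, ¬ (x ∈ esupp (U 0) ∧ x ∈ esupp (U 1) ∧ x ∈ esupp (U 2)))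
      ∨ (∃ e ∈ S, (∀ i, DeterminedBy (U i) (↑(S.erase e) : Set κ)) ∧ P (S.erase e) U)
      ∨ (∃ e ∈ S, ∃ G' H' : Fin 3 → Set (Set κ),
          Reaches ![secAt e true (U 0), secAt e true (U 1), secAt e true (U 2)]
              ![secAt e false (U 0), secAt e false (U 1), secAt e false (U 2)] G' H'
          ∧ (∀ i, DeterminedBy (G' i) (↑(S.erase e) : Set κ) ∧ DeterminedBy (H' i) (↑(S.erase e) : Set κ))
          ∧ P (S.erase e) ![secAt e true (U 0), secAt e true (U 1), secAt e true (U 2)]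
          ∧ P (S.erase e) ![secAt e false (U 0), secAt e false (U 1), secAt e false (U 2)]
          ∧ (SatFace P (S.erase e) G' H'
             ∨ ((G' 0 ⊆ G' 1 ∪ G' 2 ∧ G' 1 ⊆ G' 0 ∪ G' 2 ∧ G' 2 ⊆ G' 0 ∪ G' 1)
                ∧ (H' 1 ∩ H' 2 ⊆ G' 0 ∧ H' 0 ∩ H' 2 ⊆ G' 1 ∧ H' 0 ∩ H' 1 ⊆ G' 2) ∧ P (S.erase e) G')))) :
    ∀ (S : Finset κ) (U : Fin 3 → Set (Set κ)), P S U → (∀ i, IsUpperSet (U i)) → (∀ i, DeterminedBy (U i) (↑S : Set κ)) →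
      0 ≤ sahiE3 (prodBernoulli q) (U 0) (U 1) (U 2) := by
  -- Absorb exit (t) into the predicate: run the move recursion on `P' S U := P S U`, discharging class T directly where it occurs.
  suffices key : ∀ (m : ℕ) (S : Finset κ) (U : Fin 3 → Set (Set κ)), S.card = m → P S U → (∀ i, IsUpperSet (U i)) →
      (∀ i, DeterminedBy (U i) (↑S : Set κ)) → 0 ≤ sahiE3 (prodBernoulli q) (U 0) (U 1) (U 2) from
    fun S U hPU hU hUS => key _ S U rfl hPU hU hUS
  intro m
  induction m using Nat.strong_induction_on with
  | _ m ih =>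
  intro S U hS hPU hU hUS
  rcases hP S U hPU with ⟨i, hi⟩ | ⟨T₀, T₁, hT, hdet⟩ | hT | ⟨e, heS, hdet, hPe⟩ | ⟨e, heS, G', H', hR, hdet', hP1, hP0, hface⟩
  · refine SahiAbsorbed.kahn_sahiE3_nonneg_of_inter_subset q (U 0) (U 1) (U 2) (hU 0) (hU 1) (hU 2) i fun ω hω => ?_
    have h := hi ω fun k hk => by
      have := hω k hk
      fin_cases k <;> simpa using this
    fin_cases i <;> simpa using h
  · exact sahiE3_nonneg_of_sharedLeOne q U hU T₀ T₁ hT hdet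
  · -- (t) class T
    have h := SahiClassTCube.sahiE_three_nonneg_of_classT' U hU hT q
    have e3 : (fun i => ind (U i)) = ![ind (U 0), ind (U 1), ind (U 2)] := by
      funext i; fin_cases i <;> rfl
    rw [e3, sahiE_three_ind] at h
    exact h
  · have hlt : (S.erase e).card < m := by rw [← hS]; exact Finset.card_erase_lt_of_mem heS
    exact ih _ hlt (S.erase e) U rfl hPe hU hdet
  · have hlt : (S.erase e).card < m := by rw [← hS]; exact Finset.card_erase_lt_of_mem heS
    set G : Fin 3 → Set (Set κ) := ![secAt e true (U 0), secAt e true (U 1), secAt e true (U 2)] with hGdef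
    set H : Fin 3 → Set (Set κ) := ![secAt e false (U 0), secAt e false (U 1), secAt e false (U 2)] with hHdef
    have hGup : ∀ i, IsUpperSet (G i) := fun i => by
      rw [hGdef, secTriple_apply]; exact isUpperSet_secAt e true (hU i)
    have hHup : ∀ i, IsUpperSet (H i) := fun i => by
      rw [hHdef, secTriple_apply]; exact isUpperSet_secAt e false (hU i)
    have hHG : ∀ i, H i ⊆ G i := fun i => by
      rw [hGdef, hHdef, secTriple_apply, secTriple_apply]; exact SahiTwoLevel.secAt_false_subset_true e (hU i)
    have hN : NestedUp G H := ⟨hGup, hHup, hHG⟩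
    have hN' : NestedUp G' H' := nestedUp_of_reaches hR hN
    have h1 : 0 ≤ sahiE3 (prodBernoulli q) (secAt e true (U 0)) (secAt e true (U 1)) (secAt e true (U 2)) := by
      have := ih _ hlt (S.erase e) G rfl hP1 hGup
        (fun i => by rw [hGdef, secTriple_apply]; exact determinedBy_secAt e true (hUS i))
      simpa [hGdef] using this
    have h0 : 0 ≤ sahiE3 (prodBernoulli q) (secAt e false (U 0)) (secAt e false (U 1)) (secAt e false (U 2)) := by
      have := ih _ hlt (S.erase e) H rfl hP0 hHup
        (fun i => by rw [hHdef, secTriple_apply]; exact determinedBy_secAt e false (hUS i))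
      simpa [hHdef] using this
    have hKahn : ∀ X : Fin 3 → Set (Set κ), (∀ i, X i = G' i ∨ X i = H' i) → P (S.erase e) X →
        0 ≤ sahiE3 (prodBernoulli q) (X 0) (X 1) (X 2) := by
      intro X hX hPX
      have hup : ∀ i, IsUpperSet (X i) := by
        intro i; rcases hX i with h | h <;> rw [h]
        · exact hN'.1 i
        · exact hN'.2.1 i
      have hdet : ∀ i, DeterminedBy (X i) (↑(S.erase e) : Set κ) := by
        intro i; rcases hX i with h | h <;> rw [h]
        · exact (hdet' i).1
        · exact (hdet' i).2
      exact ih _ hlt (S.erase e) X rfl hPX hup hdet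
    have hT' : 0 ≤ topForm q G' H' := by
      rcases hface with hface | ⟨⟨hc0, hc1, hc2⟩, ⟨hm0, hm1, hm2⟩, hPG'⟩
      · exact topForm_nonneg_of_satFace q P (S.erase e) G' H' hN' hKahn hface
      · exact topForm_nonneg_of_coSunflowerTops q G' H' hN'.2.2 hc0 hc1 hc2 hm0 hm1 hm2 (hKahn G' (fun i => Or.inl rfl) hPG')
    have hT : 0 ≤ topForm q G H := hT'.trans (topForm_le_of_reaches q hR hN)
    exact sahiE3_nonneg_of_topForm_secAt_nonneg q e (hU 0) (hU 1) (hU 2) hT h0 h1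


end SahiTwoLevelVariational

end Summit.CriticalPhenomena.PercolationContinuityZ3.Theorems
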